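import Mathlib.RingTheory.MvPowerSeries.Substitution
import Mathlib.RingTheory.MvPowerSeries.Order
import Mathlib.RingTheory.PowerSeries.Substitution
import Mathlib.RingTheory.FormalGroup.Basic
import HarnessLib

/-!
# Congruences modulo total degree for (multivariate) power series: Lazard's substitution lemma
# ([Lazard 1955] §I, Lemme 1)

Topic `Literature/RingTheory/FormalGroups`; namespace `Literature.RingTheory.FormalGroups`.  THEOREMS ONLY (no definition,
no named fact, no instance, no `sorry`): the elementary calculus of congruences `F ≡ G (mod deg N)` between power series —
"all coefficients of total degree `< N` agree", spelled with Mathlib's `MvPowerSeries.order` as `↑N ≤ (F - G).order` —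
which Lazard uses throughout *Sur les groupes de Lie formels à un paramètre* («Ce lemme sera très souvent utilisé»):

* §1 arithmetic: `natCast_le_order_iff`, sums, products (`natCast_add_le_order_mul`), powers and products of powers of
  congruent arguments (`le_order_pow_sub_pow`, `le_order_prod_pow_sub_prod_pow`: if `aᵢ ≡ bᵢ (mod deg N)` with `aᵢ(0) =
  bᵢ(0) = 0` then `∏ aᵢ^{eᵢ} ≡ ∏ bᵢ^{eᵢ} (mod deg N + Σeᵢ - 1)`).
* §2 **Lazard's Lemme 1** `le_order_subst_sub_subst`: if `f ≡ 0 (mod deg r)` (`r ≥ 1`) and `aᵢ ≡ bᵢ (mod deg N)`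
  (`N ≥ 1`, all without constant term) then `f(a) ≡ f(b) (mod deg N + r - 1)`; the case of a general `f`
  (`le_order_subst_sub_subst'`, modulus `N`) and the univariate form (`le_order_psubst_sub_psubst`).
* §3 first-order consequences for formal group laws and strict series
  (`formalGroup_le_order_subst_sub_subst_sub`: `H(a) ≡ H(b) + (a₀ - b₀) + (a₁ - b₁) (mod deg N+1)` for a law `H`) and
  `le_order_psubst_sub_psubst_sub` (`ψ(u) ≡ ψ(u') + (u - u') (mod deg N+1)` for `ψ ≡ X (mod deg 2)`).

## References
* [Lazard1955] M. Lazard, Bull. SMF 83 (1955), §I, Lemme 1 (p. 254) and its use in Lemme 2 / Lemme 4.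
* [Hazewinkel1978] M. Hazewinkel, *Formal Groups and Applications* (1978), §1.1, §5.7 (congruences `mod (degree n)`).

## Design notes
No new predicate is introduced: `F ≡ G (mod deg N)` is `(N : ℕ∞) ≤ (F - G).order` (equivalently
`∀ d, d.degree < N → coeff d F = coeff d G`, `natCast_le_order_sub_iff`).  Substitution is Mathlib's
`MvPowerSeries.subst` / `PowerSeries.subst` (finitely many variables, arguments without constant term).
-/

noncomputable section

namespace Literature.RingTheory.FormalGroups

open MvPowerSeries Finsupp

universe u v w

variable {σ : Type u} {τ : Type v} {R : Type w} [CommRing R]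

/-! ## §1 Arithmetic of `↑N ≤ F.order` -/

/-- `↑N ≤ F.order` iff all coefficients of total degree `< N` vanish. [cite: Lazard1955, §I Lemme 1] -/
theorem natCast_le_order_iff {N : ℕ} {F : MvPowerSeries τ R} :
    (N : ℕ∞) ≤ F.order ↔ ∀ d : τ →₀ ℕ, d.degree < N → coeff d F = 0 := by
  refine ⟨fun h d hd => coeff_of_lt_order (lt_of_lt_of_le (by exact_mod_cast hd) h), fun h => nat_le_order h⟩

/-- `F ≡ G (mod deg N)` iff the coefficients of degree `< N` agree. [cite: Lazard1955, §I Lemme 1] -/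
theorem natCast_le_order_sub_iff {N : ℕ} {F G : MvPowerSeries τ R} :
    (N : ℕ∞) ≤ (F - G).order ↔ ∀ d : τ →₀ ℕ, d.degree < N → coeff d F = coeff d G := by
  rw [natCast_le_order_iff]
  simp only [map_sub, sub_eq_zero]

/-- Monotonicity in the modulus. [cite: Lazard1955, §I Lemme 1] -/
theorem natCast_le_order_of_le {N M : ℕ} {F : MvPowerSeries τ R} (h : (N : ℕ∞) ≤ F.order) (hMN : M ≤ N) :
    (M : ℕ∞) ≤ F.order :=
  le_trans (by exact_mod_cast hMN) h

/-- Sums. [cite: Lazard1955, §I Lemme 1] -/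
theorem natCast_le_order_add {N : ℕ} {F G : MvPowerSeries τ R} (hF : (N : ℕ∞) ≤ F.order) (hG : (N : ℕ∞) ≤ G.order) :
    (N : ℕ∞) ≤ (F + G).order :=
  le_trans (le_min hF hG) (min_order_le_add)

/-- Differences. [cite: Lazard1955, §I Lemme 1] -/
theorem natCast_le_order_sub {N : ℕ} {F G : MvPowerSeries τ R} (hF : (N : ℕ∞) ≤ F.order) (hG : (N : ℕ∞) ≤ G.order) :
    (N : ℕ∞) ≤ (F - G).order := by
  rw [sub_eq_add_neg]
  exact natCast_le_order_add hF (by rwa [order_neg])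

/-- Transitivity of congruences. [cite: Lazard1955, §I Lemme 1] -/
theorem natCast_le_order_sub_trans {N : ℕ} {F G H : MvPowerSeries τ R} (h₁ : (N : ℕ∞) ≤ (F - G).order)
    (h₂ : (N : ℕ∞) ≤ (G - H).order) : (N : ℕ∞) ≤ (F - H).order := by
  have := natCast_le_order_add h₁ h₂
  rwa [sub_add_sub_cancel] at this

/-- Symmetry of congruences. [cite: Lazard1955, §I Lemme 1] -/
theorem natCast_le_order_sub_comm {N : ℕ} {F G : MvPowerSeries τ R} (h : (N : ℕ∞) ≤ (F - G).order) :
    (N : ℕ∞) ≤ (G - F).order := by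
  rwa [← neg_sub, order_neg]

/-- Finite sums. [cite: Lazard1955, §I Lemme 1] -/
theorem natCast_le_order_sum {N : ℕ} {ι : Type*} (s : Finset ι) {F : ι → MvPowerSeries τ R}
    (h : ∀ i ∈ s, (N : ℕ∞) ≤ (F i).order) : (N : ℕ∞) ≤ (∑ i ∈ s, F i).order := by
  rw [natCast_le_order_iff]
  intro d hd
  rw [map_sum]
  exact Finset.sum_eq_zero fun i hi => (natCast_le_order_iff.mp (h i hi)) d hd

/-- Products: orders add. [cite: Lazard1955, §I Lemme 1] -/
theorem natCast_add_le_order_mul {N M : ℕ} {F G : MvPowerSeries τ R} (hF : (N : ℕ∞) ≤ F.order)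
    (hG : (M : ℕ∞) ≤ G.order) : ((N + M : ℕ) : ℕ∞) ≤ (F * G).order := by
  push_cast
  exact le_trans (add_le_add hF hG) (le_order_mul)

/-- Left multiples. [cite: Lazard1955, §I Lemme 1] -/
theorem natCast_le_order_mul_left {N : ℕ} {F : MvPowerSeries τ R} (G : MvPowerSeries τ R)
    (hF : (N : ℕ∞) ≤ F.order) : (N : ℕ∞) ≤ (G * F).order := by
  have h := natCast_add_le_order_mul (N := 0) (M := N) (F := G) (G := F) (by simp) hF
  rwa [zero_add] at h

/-- A series without constant term has order `≥ 1`. [cite: Lazard1955, §I Lemme 1] -/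
theorem one_le_order_of_constantCoeff {F : MvPowerSeries τ R} (h : constantCoeff F = 0) :
    ((1 : ℕ) : ℕ∞) ≤ F.order := by
  rw [Nat.cast_one]
  exact (one_le_order_iff_constCoeff_eq_zero).mpr h

/-- Powers of a series without constant term: `k ≤ order (F^k)`. [cite: Lazard1955, §I Lemme 1] -/
theorem natCast_le_order_pow {F : MvPowerSeries τ R} (h : constantCoeff F = 0) (k : ℕ) :
    (k : ℕ∞) ≤ (F ^ k).order :=
  le_order_pow_of_constantCoeff_eq_zero k h

/-- **Powers of congruent arguments**: if `x ≡ x' (mod deg N)` and `x(0) = x'(0) = 0` then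
`x^k ≡ x'^k (mod deg N + k - 1)` (`k ≥ 1`). [cite: Lazard1955, §I Lemme 1] -/
theorem le_order_pow_sub_pow {N : ℕ} {x x' : MvPowerSeries τ R} (hx : constantCoeff x = 0)
    (hx' : constantCoeff x' = 0) (h : (N : ℕ∞) ≤ (x - x').order) :
    ∀ k : ℕ, 1 ≤ k → ((N + k - 1 : ℕ) : ℕ∞) ≤ (x ^ k - x' ^ k).order := by
  intro k hk
  induction k with
  | zero => omega
  | succ k ih =>
    rcases Nat.eq_zero_or_pos k with rfl | hk0
    · simpa using h
    · have e : x ^ (k + 1) - x' ^ (k + 1) = (x - x') * x ^ k + x' * (x ^ k - x' ^ k) := by ring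
      rw [e]
      have h1 : ((N + k : ℕ) : ℕ∞) ≤ ((x - x') * x ^ k).order := natCast_add_le_order_mul h (natCast_le_order_pow hx k)
      have h2 : ((1 + (N + k - 1) : ℕ) : ℕ∞) ≤ (x' * (x ^ k - x' ^ k)).order :=
        natCast_add_le_order_mul (one_le_order_of_constantCoeff hx') (ih hk0)
      exact natCast_le_order_add (natCast_le_order_of_le h1 (by omega)) (natCast_le_order_of_le h2 (by omega))

/-- **Products of powers of congruent arguments**: if `aᵢ ≡ bᵢ (mod deg N)` (`N ≥ 1`) with `aᵢ(0) = bᵢ(0) = 0` then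
`∏_{i∈s} aᵢ^{eᵢ} ≡ ∏_{i∈s} bᵢ^{eᵢ} (mod deg N + Σ_{i∈s} eᵢ - 1)`. [cite: Lazard1955, §I Lemme 1] -/
theorem le_order_prod_pow_sub_prod_pow {N : ℕ} (hN : 1 ≤ N) {a b : σ → MvPowerSeries τ R}
    (ha : ∀ i, constantCoeff (a i) = 0) (hb : ∀ i, constantCoeff (b i) = 0)
    (hab : ∀ i, (N : ℕ∞) ≤ (a i - b i).order) (e : σ → ℕ) (s : Finset σ) :
    ((N + (∑ i ∈ s, e i) - 1 : ℕ) : ℕ∞) ≤ ((∏ i ∈ s, a i ^ e i) - ∏ i ∈ s, b i ^ e i).order := by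
  classical
  induction s using Finset.induction_on with
  | empty => simp
  | insert i s hi ih =>
    rw [Finset.prod_insert hi, Finset.prod_insert hi, Finset.sum_insert hi]
    have e1 : a i ^ e i * ∏ j ∈ s, a j ^ e j - b i ^ e i * ∏ j ∈ s, b j ^ e j =
        (a i ^ e i - b i ^ e i) * ∏ j ∈ s, a j ^ e j + b i ^ e i * (∏ j ∈ s, a j ^ e j - ∏ j ∈ s, b j ^ e j) := by ring
    rw [e1]
    refine natCast_le_order_add ?_ ?_
    · rcases Nat.eq_zero_or_pos (e i) with h0 | hpos
      · rw [h0, pow_zero, pow_zero, sub_self, zero_mul]; simp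
      · have h1 := le_order_pow_sub_pow (ha i) (hb i) (hab i) (e i) hpos
        have h2 : ((∑ j ∈ s, e j : ℕ) : ℕ∞) ≤ (∏ j ∈ s, a j ^ e j).order := by
          have := le_order_prod (fun j => a j ^ e j) s
          refine le_trans ?_ this
          push_cast
          exact Finset.sum_le_sum fun j _ => natCast_le_order_pow (ha j) (e j)
        exact natCast_le_order_of_le (natCast_add_le_order_mul h1 h2) (by omega)
    · have h1 : ((e i : ℕ) : ℕ∞) ≤ (b i ^ e i).order := natCast_le_order_pow (hb i) (e i)
      exact natCast_le_order_of_le (natCast_add_le_order_mul h1 ih) (by omega)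

/-! ## §2 Lazard's Lemme 1: substitution of congruent arguments -/

section Subst

variable [Finite σ]

/-- **Lazard's Lemme 1.**  Let `f ≡ 0 (mod deg r)` (`r ≥ 1`) and let `aᵢ ≡ bᵢ (mod deg N)` (`N ≥ 1`) be arguments without
constant term.  Then `f(a) ≡ f(b) (mod deg N + r - 1)`.  (Proof: `f(a) - f(b) = Σ_e f_e (a^e - b^e)` with `|e| ≥ r`, and
`a^e ≡ b^e (mod deg N + |e| - 1)`.) [cite: Lazard1955, §I Lemme 1] -/
theorem le_order_subst_sub_subst {r N : ℕ} (hr : 1 ≤ r) (hN : 1 ≤ N) {f : MvPowerSeries σ R}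
    (hf : (r : ℕ∞) ≤ f.order) {a b : σ → MvPowerSeries τ R}
    (ha : ∀ i, constantCoeff (a i) = 0) (hb : ∀ i, constantCoeff (b i) = 0)
    (hab : ∀ i, (N : ℕ∞) ≤ (a i - b i).order) :
    ((N + r - 1 : ℕ) : ℕ∞) ≤ (f.subst a - f.subst b).order := by
  classical
  rw [natCast_le_order_iff]
  intro d hd
  rw [map_sub, coeff_subst (hasSubst_of_constantCoeff_zero ha), coeff_subst (hasSubst_of_constantCoeff_zero hb),
    ← finsum_sub_distrib (coeff_subst_finite (hasSubst_of_constantCoeff_zero ha) f d)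
      (coeff_subst_finite (hasSubst_of_constantCoeff_zero hb) f d)]
  refine finsum_eq_zero_of_forall_eq_zero fun e => ?_
  by_cases he : e.degree < r
  · rw [coeff_of_lt_order (lt_of_lt_of_le (by exact_mod_cast he) hf), zero_smul, zero_smul, sub_self]
  · rw [not_lt] at he
    rw [← smul_sub, ← map_sub]
    have key := le_order_prod_pow_sub_prod_pow hN ha hb hab e e.support
    rw [← Finsupp.degree_apply] at key
    have hlt : d.degree < N + e.degree - 1 := by omega
    rw [Finsupp.prod, Finsupp.prod, coeff_of_lt_order (lt_of_lt_of_le (by exact_mod_cast hlt) key), smul_zero]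

/-- Lazard's Lemme 1 for an arbitrary `f`: `aᵢ ≡ bᵢ (mod deg N)` (no constant terms) implies `f(a) ≡ f(b) (mod deg N)`.
[cite: Lazard1955, §I Lemme 1] -/
theorem le_order_subst_sub_subst' {N : ℕ} {f : MvPowerSeries σ R} {a b : σ → MvPowerSeries τ R}
    (ha : ∀ i, constantCoeff (a i) = 0) (hb : ∀ i, constantCoeff (b i) = 0)
    (hab : ∀ i, (N : ℕ∞) ≤ (a i - b i).order) :
    (N : ℕ∞) ≤ (f.subst a - f.subst b).order := by
  rcases Nat.eq_zero_or_pos N with rfl | hN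
  · simp
  set f' : MvPowerSeries σ R := f - C (constantCoeff f) with hf'
  have hf'0 : ((1 : ℕ) : ℕ∞) ≤ f'.order := one_le_order_of_constantCoeff (by simp [hf'])
  have hfa : ∀ c : σ → MvPowerSeries τ R, (∀ i, constantCoeff (c i) = 0) →
      f.subst c = C (constantCoeff f) + f'.subst c := by
    intro c hc
    have hcs := hasSubst_of_constantCoeff_zero hc
    rw [hf', subst_sub hcs, subst_C]
    ring
  rw [hfa a ha, hfa b hb, add_sub_add_left_eq_sub]
  have h := le_order_subst_sub_subst le_rfl hN hf'0 ha hb hab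
  simpa using h

/-- A univariate series `ψ` with `ψ ≡ 0 (mod deg r)` in the sense of its coefficients has `MvPowerSeries.order ≥ r`.
[cite: Lazard1955, §I Lemme 1] -/
theorem natCast_le_order_of_coeff_eq_zero {r : ℕ} {ψ : PowerSeries R} (h : ∀ i < r, PowerSeries.coeff i ψ = 0) :
    (r : ℕ∞) ≤ MvPowerSeries.order ψ := by
  rw [natCast_le_order_iff]
  intro d hd
  have hd' : d = Finsupp.single () (d ()) := Finsupp.ext fun u => by cases u; simp
  have hdeg : d.degree = d () := by rw [hd', Finsupp.degree_single]; simp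
  rw [← PowerSeries.coeff_def (s := d) rfl]
  exact h _ (by rw [← hdeg]; exact hd)

/-- Lazard's Lemme 1, univariate outer series: `ψ ≡ 0 (mod deg r)` (`r ≥ 1`), `u ≡ u' (mod deg N)` (`N ≥ 1`, no constant
terms) imply `ψ(u) ≡ ψ(u') (mod deg N + r - 1)`. [cite: Lazard1955, §I Lemme 1] -/
theorem le_order_psubst_sub_psubst {r N : ℕ} (hr : 1 ≤ r) (hN : 1 ≤ N) {ψ : PowerSeries R}
    (hψ : ∀ i < r, PowerSeries.coeff i ψ = 0) {u u' : MvPowerSeries τ R}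
    (hu : constantCoeff u = 0) (hu' : constantCoeff u' = 0) (huu' : (N : ℕ∞) ≤ (u - u').order) :
    ((N + r - 1 : ℕ) : ℕ∞) ≤ (PowerSeries.subst u ψ - PowerSeries.subst u' ψ).order := by
  rw [PowerSeries.subst_def, PowerSeries.subst_def]
  exact le_order_subst_sub_subst hr hN (natCast_le_order_of_coeff_eq_zero hψ) (fun _ => hu) (fun _ => hu')
    (fun _ => huu')

/-- Lazard's Lemme 1, univariate outer series, arbitrary `ψ`: `u ≡ u' (mod deg N)` implies `ψ(u) ≡ ψ(u') (mod deg N)`.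
[cite: Lazard1955, §I Lemme 1] -/
theorem le_order_psubst_sub_psubst' {N : ℕ} (ψ : PowerSeries R) {u u' : MvPowerSeries τ R}
    (hu : constantCoeff u = 0) (hu' : constantCoeff u' = 0) (huu' : (N : ℕ∞) ≤ (u - u').order) :
    (N : ℕ∞) ≤ (PowerSeries.subst u ψ - PowerSeries.subst u' ψ).order := by
  rw [PowerSeries.subst_def, PowerSeries.subst_def]
  exact le_order_subst_sub_subst' (fun _ => hu) (fun _ => hu') (fun _ => huu')

end Subst

/-! ## §3 First-order consequences: formal group laws and strict series -/

section FirstOrder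

/-- A two-variable exponent of total degree `≤ 1` is `0`, `(1,0)` or `(0,1)`. [folklore] -/
private theorem fin_two_degree_lt_two {d : Fin 2 →₀ ℕ} (hd : d.degree < 2) :
    d = 0 ∨ d = Finsupp.single 0 1 ∨ d = Finsupp.single 1 1 := by
  rw [Finsupp.degree_eq_sum, Fin.sum_univ_two] at hd
  have key : ∀ e : Fin 2 →₀ ℕ, e = Finsupp.single 0 (e 0) + Finsupp.single 1 (e 1) := by
    intro e; ext i; fin_cases i <;> simp
  rcases Nat.eq_zero_or_pos (d 0) with h0 | h0 <;> rcases Nat.eq_zero_or_pos (d 1) with h1 | h1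
  · left; rw [key d, h0, h1]; simp
  · right; right; rw [key d, h0, show d 1 = 1 by omega]; simp
  · right; left; rw [key d, h1, show d 0 = 1 by omega]; simp
  · omega

/-- The non-linear part `H(X,Y) - X - Y` of a formal group law is `≡ 0 (mod deg 2)`. [cite: Lazard1955, §I (1.1)] -/
theorem formalGroup_two_le_order_sub_X_sub_X (H : FormalGroup R) :
    ((2 : ℕ) : ℕ∞) ≤ (H.toPowerSeries - X 0 - X 1).order := by
  classical
  rw [natCast_le_order_iff]
  intro d hd
  rcases fin_two_degree_lt_two hd with rfl | rfl | rfl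
  · simp only [map_sub, coeff_zero_eq_constantCoeff_apply, H.zero_constantCoeff, constantCoeff_X, sub_zero]
  · rw [map_sub, map_sub, H.lin_coeff_X, coeff_index_single_X, coeff_index_single_X]; simp
  · rw [map_sub, map_sub, H.lin_coeff_Y, coeff_index_single_X, coeff_index_single_X]; simp

/-- **First-order expansion of a formal group law** (Lazard's Lemme 1 with `r = 2` applied to `H - X - Y`): for arguments
`aᵢ ≡ bᵢ (mod deg N)` (`N ≥ 1`) without constant term, `H(a₀,a₁) ≡ H(b₀,b₁) + (a₀ - b₀) + (a₁ - b₁) (mod deg N+1)`.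
[cite: Lazard1955, §I Lemme 1] -/
theorem formalGroup_le_order_subst_sub_subst_sub (H : FormalGroup R) {N : ℕ} (hN : 1 ≤ N)
    {a b : Fin 2 → MvPowerSeries τ R} (ha : ∀ i, constantCoeff (a i) = 0) (hb : ∀ i, constantCoeff (b i) = 0)
    (hab : ∀ i, (N : ℕ∞) ≤ (a i - b i).order) :
    ((N + 1 : ℕ) : ℕ∞) ≤ (H.toPowerSeries.subst a - H.toPowerSeries.subst b - ((a 0 - b 0) + (a 1 - b 1))).order := by
  set H₂ : MvPowerSeries (Fin 2) R := H.toPowerSeries - X 0 - X 1 with hH₂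
  have hsplit : ∀ c : Fin 2 → MvPowerSeries τ R, (∀ i, constantCoeff (c i) = 0) →
      H.toPowerSeries.subst c = c 0 + c 1 + H₂.subst c := by
    intro c hc
    have hcs := hasSubst_of_constantCoeff_zero hc
    rw [hH₂, subst_sub hcs, subst_sub hcs, subst_X hcs, subst_X hcs]
    ring
  rw [hsplit a ha, hsplit b hb]
  have h := le_order_subst_sub_subst (by norm_num) hN (formalGroup_two_le_order_sub_X_sub_X H) ha hb hab
  have e : a 0 + a 1 + H₂.subst a - (b 0 + b 1 + H₂.subst b) - (a 0 - b 0 + (a 1 - b 1)) = H₂.subst a - H₂.subst b := by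
    ring
  rw [e]
  exact natCast_le_order_of_le h (by omega)

/-- **First-order expansion of a strict series** `ψ ≡ X (mod deg 2)`: for `u ≡ u' (mod deg N)` (`N ≥ 1`) without constant
term, `ψ(u) ≡ ψ(u') + (u - u') (mod deg N+1)`. [cite: Lazard1955, §I Lemme 1] -/
theorem le_order_psubst_sub_psubst_sub {ψ : PowerSeries R} (h0 : PowerSeries.constantCoeff ψ = 0)
    (h1 : PowerSeries.coeff 1 ψ = 1) {N : ℕ} (hN : 1 ≤ N) {u u' : MvPowerSeries τ R}
    (hu : constantCoeff u = 0) (hu' : constantCoeff u' = 0) (huu' : (N : ℕ∞) ≤ (u - u').order) :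
    ((N + 1 : ℕ) : ℕ∞) ≤ (PowerSeries.subst u ψ - PowerSeries.subst u' ψ - (u - u')).order := by
  set ψ₂ : PowerSeries R := ψ - PowerSeries.X with hψ₂
  have hψ₂c : ∀ i < 2, PowerSeries.coeff i ψ₂ = 0 := by
    intro i hi
    have hi' : i = 0 ∨ i = 1 := by omega
    rcases hi' with rfl | rfl
    · simp [hψ₂, h0]
    · simp [hψ₂, h1, PowerSeries.coeff_one_X]
  have hsplit : ∀ c : MvPowerSeries τ R, constantCoeff c = 0 →
      PowerSeries.subst c ψ = c + PowerSeries.subst c ψ₂ := by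
    intro c hc
    have hcs := PowerSeries.HasSubst.of_constantCoeff_zero hc
    rw [hψ₂, PowerSeries.subst_sub hcs, PowerSeries.subst_X hcs]
    ring
  rw [hsplit u hu, hsplit u' hu']
  have h := le_order_psubst_sub_psubst (by norm_num) hN hψ₂c hu hu' huu'
  have e : u + PowerSeries.subst u ψ₂ - (u' + PowerSeries.subst u' ψ₂) - (u - u') =
      PowerSeries.subst u ψ₂ - PowerSeries.subst u' ψ₂ := by ring
  rw [e]
  exact natCast_le_order_of_le h (by omega)

end FirstOrder

end Literature.RingTheory.FormalGroups
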